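import Summits.HubbardSuperconductivity.HubbardSuperconductivity.Theses.ProjectedBCSGas
import Literature.MathematicalPhysics.QuantumLattice.HubbardHubbardModelProofs
import Literature.MathematicalPhysics.QuantumLattice.ProjectedBCSState
import Literature.MathematicalPhysics.QuantumLattice.LatticeToriProofs
import HarnessLib

/-!
# Crux `ProjectedBCSPairLRO` (stmt-HubbardSuperconductivity-1233; route `ProjectedBCSGas`, rank 2 —
"the prize") — LINE `birth` (ORDER × CLUSTERING), lead's reshaped skeleton (wave 1)

THE CRUX (fixed; `Theses/ProjectedBCSGas.lean`, decl `ProjectedBCSPairLRO`, not restated here): for EVERY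
`g ∈ [0,1]`, `Δv ∈ (0,4]`, `μ ∈ [-4,4]`, `δ ∈ (0,1/2)`, the explicit (partially) Gutzwiller-projected,
number-projected d-wave BCS family `χ[g,Δv,μ,δ]_L` has a UNIFORM d-wave pair-coherence floor at large
torus distance: `∃ a > 0, R, L₀` with `a ≤ G_χ(L; x, y) := pairFieldCorr dWaveFormFactor χ L x y` for all
even `L ≥ L₀` and all `torusDist x y ≥ R`.

NAMED FORM OF THE FAMILY. The route's inlined `let`-chain is, by `rfl`
(`Literature…ProjectedBCSState.projectedBCSState_eq`), the Literature state
`χ_L = projectedBCSState g Δv μ L N_L = fockNormalize (raw_L)`,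
`raw_L = fun s => projWeight g N_L s * ProjectedBCS.bcsState L Δv μ s` (`= P_g P_{N_L} |dBCS⟩`),
`N_L = 2 ⌊(1 - δ) L² / 2⌋₊`. All stubs below are stated in this named vocabulary (no restatement of the
crux: the composition concludes the crux BY NAME and the two spellings agree definitionally).

THE LINE — "ORDER × CLUSTERING" (the crux's own declared mechanism, Yang 1962 §4 / Penrose–Onsager 1956:
for a number-conserving state, pair ODLRO = non-zero AVERAGED order parameter + asymptotic FLATNESS of
the pair correlator; plus the a-priori bound every averaging argument needs), reshaped by the lead into
six registered stubs so that the provable infrastructure is separated from the open content: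

1. `stub_pairCorrBounded` — A-PRIORI BOUND (theorem-grade, all real parameters): `|G_χ(L;x,y)| ≤ C`.
2. `stub_pairCorrTranslate` — TRANSLATION INVARIANCE (theorem-grade, all real parameters):
   `G_χ(L; x+z, y+z) = G_χ(L; x, y)` (zero-momentum pairs: `T_z b_k T_z⁻¹ = b_k`, `T_z|0⟩ = |0⟩`, `T_z`
   commutes with `P_N`, `P_g`; unitarity of the relabelling).
3. `stub_farPairFlatness` — CLUSTERING in ONE variable (open for `g < 1`): `r ↦ G_χ(L; 0, r)` is
   `ε`-flat across `‖r‖ ≥ R`, even `L ≥ L₀`.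
4. `stub_rawOrder` — ORDER, homogeneous form (THE BET; crux-sized at `g = 0`):
   `a L⁴ ⟨raw_L, raw_L⟩ ≤ ⟨raw_L, Δ_d† Δ_d raw_L⟩` for even `L ≥ L₀` (true trivially where `raw_L = 0`,
   so it carries no non-vanishing content).
5. `stub_rawNonvanishing_pos` — NON-VANISHING for `g ∈ (0,1]` (theorem-grade, M–L): `raw_L ≠ 0` for all
   large even `L` (`P_N |dBCS⟩ ≠ 0`: a momentum configuration `S` with `|S| = N/2`, `v ≠ 0` on `S`,
   `u ≠ 0` off `S` has overlap `Π_S v Π_{Sᶜ} u ≠ 0`; `g^D ≠ 0`).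
6. `stub_rawNonvanishing_zero` — NON-VANISHING at `g = 0` (the RVB state `P_G P_N |dBCS⟩ ≠ 0`; genuine:
   a doublon-free configuration with non-zero determinant `det φ(x_a - y_b)`), the load-bearing implicit
   lemma flagged by every review of the route.

COMPOSITION `ProjectedBCSPairLRO_of : ProjectedBCSPairLRO` (A12 convention: concludes the crux BY NAME, no
hypotheses, cites the six declared stubs by name; sorry-free outside the stubs): non-vanishing (5 ∨ 6 by
cases on `g = 0 ∨ g > 0`) turns the homogeneous order (4) into Scalapino's averaged order
`a L⁴ ≤ Σ_{x,y} G_χ` (`meanOrder_of_rawOrder`: `Σ G_χ = ‖raw‖⁻² ⟨raw, Δ_d†Δ_d raw⟩`); translation (2)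
turns one-variable flatness (3) into two-variable flatness (`flat_of_translate_flat`); with the bound (1)
the generic averaging lemma `farFloor_of_mean_bounded_flat` (mean + bound + flatness ⇒ pointwise far-pair
floor `a/4`) gives the crux with witnesses `(a/4, R, L_*)`.

DISPROOF USED: no `Cruxes/ProjectedBCSPairLRO/Disproof.lean` exists (2026-08-17, `ledger crux ls`).

Sources: C. N. Yang, Rev. Mod. Phys. 34 (1962) 694, §4; O. Penrose, L. Onsager, Phys. Rev. 104 (1956) 576;
D. J. Scalapino, Phys. Rep. 250 (1995) 329, §2 eq. (2.4); A. Paramekanti, M. Randeria, N. Trivedi, PRL 87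
(2001) 217002, PRB 70 (2004) 054504; C. Gros, Ann. Phys. 189 (1989) 53; V. Bach, E. H. Lieb,
J. P. Solovej, J. Stat. Phys. 76 (1994) 3; W. Metzner, D. Vollhardt, PRB 37 (1988) 7382.
No definition is introduced; all statements are over existing declarations.
-/

noncomputable section

-- `dupNamespace`: the summit and the problem are both named `HubbardSuperconductivity` (layout D-0022)
set_option linter.dupNamespace false

namespace Summit.HubbardSuperconductivity.HubbardSuperconductivity.Cruxes.ProjectedBCSPairLRO.Birth

open scoped BigOperators Topology Manifold Classical MeasureTheory ProbabilityTheory Matrix InnerProductSpace ComplexConjugate ContinuousMap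
open Filter Set Function TopologicalSpace MeasureTheory
open Literature.Hubbard
open Literature.MathematicalPhysics.QuantumLattice Literature.Probability.LatticeModels

/-! ## The six stubs -/

/-- **STUB 1 `stub_pairCorrBounded` — A-PRIORI BOUND (theorem-grade; all real parameters).** The family
`χ_L = projectedBCSState g Δv μ L N_L = fockNormalize raw_L` is sub-normalised (`‖χ_L‖ ∈ {0,1}`, Lean's
`0⁻¹ = 0`), hence `|G_χ(L; x, y)| ≤ C` for ALL sides `L` (junk value `0` at `L = 0`) and all pairs, e.g.
`C = C_d²`, `C_d = Σ_{e ∈ {0,±e₁,±e₂}} 2|d(e)|/√2`, by Cauchy–Schwarz and `‖P_x ψ‖ ≤ C_d ‖ψ‖`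
(`norm_toLp_localPair_mulVec_le`, `re_star_dotProduct_le_norm_mul_norm`, cf. `pairFieldCorr_succ_le`).
[folklore; Scalapino 1995 §2] -/
theorem stub_pairCorrBounded :
    ∀ g Δv μ δ : ℝ, ∃ C : ℝ, ∀ (L : ℕ) (x y : TorusSite 2 L),
      |pairFieldCorr dWaveFormFactor
          (fun L => projectedBCSState g Δv μ L (2 * ⌊(1 - δ) * (L : ℝ) ^ 2 / 2⌋₊)) L x y| ≤ C := by
  sorry

/-- **STUB 2 `stub_pairCorrTranslate` — TRANSLATION INVARIANCE (theorem-grade; all real parameters).**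
The d-wave pair correlator of the family is invariant under simultaneous translation of both pair
positions: `G_χ(L; x + z, y + z) = G_χ(L; x, y)` (at `L = 0` both sides are the junk value `0`).
Mechanism: the site translation `T_z` is implemented on Fock space by the signed relabelling
`relabelVec` (`ProjectedBCSStateReal` / `FermionRelabelling`); the pair creators
`b_k = L⁻² Σ_{x,y} e^{ik·(x-y)} c†_{x↑}c†_{y↓}` have zero total momentum, so `T_z b_k T_z⁻¹ = b_k`,
`T_z |0⟩ = |0⟩`, and `T_z` commutes with the diagonal weights `P_N`, `g^{#doublons}`; hence
`T_z χ_L = χ_L`, while `T_z P_x T_z⁻¹ = P_{x+z}`; unitarity of `T_z` gives the claim. [folklore] -/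
theorem stub_pairCorrTranslate :
    ∀ g Δv μ δ : ℝ, ∀ (L : ℕ) (x y z : TorusSite 2 L),
      pairFieldCorr dWaveFormFactor
          (fun L => projectedBCSState g Δv μ L (2 * ⌊(1 - δ) * (L : ℝ) ^ 2 / 2⌋₊)) L (x + z) (y + z) =
        pairFieldCorr dWaveFormFactor
          (fun L => projectedBCSState g Δv μ L (2 * ⌊(1 - δ) * (L : ℝ) ^ 2 / 2⌋₊)) L x y := by
  sorry

/-- **STUB 3 `stub_farPairFlatness` — CLUSTERING in one variable (asymptotic flatness; open for
`g < 1`).** For every member of the family (window of the crux) and every `ε > 0` there are `R, L₀` such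
that for every even `L ≥ L₀` the correlator `r ↦ G_χ(L; 0, r)` varies by at most `ε` across
`‖r‖_∞ ≥ R`. For a number-conserving state this is the cluster property behind ODLRO (`G(0,r) → |Φ_L|²`
uniformly at large separation, Yang 1962 §4 / Penrose–Onsager 1956): decay of the truncated four-point
function of the doublon-tilted two-species determinantal/Pfaffian gas `|χ|²` (at `g = 1`: Wick + decay
of the BCS kernels `L⁻² Σ_k u_k v_k e^{ik·r}`, `L⁻² Σ_k v_k² e^{ik·r}`, uniformly in `L`; for `g < 1`:
`1-g²` Mayer expansion or a non-perturbative clustering estimate). It asserts nothing about the sign or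
size of the limiting level. Soshnikov, Russ. Math. Surv. 55 (2000) 923; Bach–Lieb–Solovej, J. Stat.
Phys. 76 (1994) 3. -/
theorem stub_farPairFlatness :
    ∀ g ∈ Set.Icc (0 : ℝ) 1, ∀ Δv ∈ Set.Ioc (0 : ℝ) 4, ∀ μ ∈ Set.Icc (-4 : ℝ) 4,
      ∀ δ ∈ Set.Ioo (0 : ℝ) (1 / 2),
      ∀ ε > (0 : ℝ), ∃ R L₀ : ℕ, ∀ L : ℕ, Even L → L₀ ≤ L →
        ∀ r r' : TorusSite 2 L, R ≤ torusNorm r → R ≤ torusNorm r' →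
          |pairFieldCorr dWaveFormFactor
              (fun L => projectedBCSState g Δv μ L (2 * ⌊(1 - δ) * (L : ℝ) ^ 2 / 2⌋₊)) L 0 r -
            pairFieldCorr dWaveFormFactor
              (fun L => projectedBCSState g Δv μ L (2 * ⌊(1 - δ) * (L : ℝ) ^ 2 / 2⌋₊)) L 0 r'| ≤ ε := by
  sorry

/-- **STUB 4 `stub_rawOrder` — ORDER, homogeneous form (THE BET; crux-sized at `g = 0`).** For every
member of the family there are `a > 0`, `L₀` with
`a · L⁴ · ⟨raw_L, raw_L⟩ ≤ re ⟨raw_L, Δ_d† Δ_d raw_L⟩` for every even side `L ≥ L₀`, where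
`raw_L = P_g P_{N_L} |dBCS⟩` is the unnormalised state and `Δ_d = pairField dWaveFormFactor L`. Where
`raw_L ≠ 0` this is exactly Scalapino's averaged d-wave pair-field order `Σ_{x,y} G_χ ≥ a L⁴` of the
normalised state (the VMC fact `Φ(g,Δv,μ,δ)² > 0`, Paramekanti–Randeria–Trivedi 2001/2004, Gros 1989, as
a theorem); where `raw_L = 0` it is trivially true, so the stub carries no non-vanishing content.
Corners: `g = 1` — `⟨P_NΨ, Δ†Δ P_NΨ⟩ ≥ |⟨P_{N-2}Ψ, Δ P_N Ψ⟩|²/‖P_{N-2}Ψ‖²` with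
`⟨Ψ, Δ P_N Ψ⟩ = Σ_k ĝ_d(k) u_k v_k ‖P_{N-2}Ψ_{∖k}‖²` termwise `≥ 0` plus ratio bounds on elementary
symmetric polynomials of `v_k²/u_k²` (equivalence of ensembles); `g ∈ [g₀,1]` — `1-g²` expansion;
`g = 0` — open. Why it might fail: the crux's own (projection transition at some `g < 1`).
Scalapino, Phys. Rep. 250 (1995) §2 eq. (2.4); Yang, Rev. Mod. Phys. 34 (1962) §4. -/
theorem stub_rawOrder :
    ∀ g ∈ Set.Icc (0 : ℝ) 1, ∀ Δv ∈ Set.Ioc (0 : ℝ) 4, ∀ μ ∈ Set.Icc (-4 : ℝ) 4,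
      ∀ δ ∈ Set.Ioo (0 : ℝ) (1 / 2),
      ∃ a > (0 : ℝ), ∃ L₀ : ℕ, ∀ (L : ℕ) [NeZero L], Even L → L₀ ≤ L →
        a * (L : ℝ) ^ 4 *
            (star (fun s => projWeight g (2 * ⌊(1 - δ) * (L : ℝ) ^ 2 / 2⌋₊) s *
                ProjectedBCS.bcsState L Δv μ s) ⬝ᵥ
              (fun s => projWeight g (2 * ⌊(1 - δ) * (L : ℝ) ^ 2 / 2⌋₊) s *
                ProjectedBCS.bcsState L Δv μ s)).re ≤
          (expect ((pairField dWaveFormFactor L)ᴴ * pairField dWaveFormFactor L)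
            (fun s => projWeight g (2 * ⌊(1 - δ) * (L : ℝ) ^ 2 / 2⌋₊) s *
              ProjectedBCS.bcsState L Δv μ s)).re := by
  sorry

/-- **STUB 5 `stub_rawNonvanishing_pos` — NON-VANISHING for `g > 0` (theorem-grade).** For `g ∈ (0,1]`
and every `(Δv, μ, δ)` in the window, the unnormalised state `raw_L = P_g P_{N_L} |dBCS⟩` is non-zero
for all large even `L`. Mechanism: `g^{#doublons} ≠ 0`, so `raw_L = 0 ⇔ P_{N_L}|dBCS⟩ = 0`; in the
momentum-mode vocabulary (`pairMode`, `momentumAnnihilation` of `ReducedBCSTorus`; product-state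
calculus of `…EdgeOrderProductState`) `|dBCS⟩ = Π_k (u_k + v_k b†_k)|0⟩` and for a set `S` of `N_L/2`
momenta with `v_k ≠ 0` on `S` and `u_k ≠ 0` off `S` (available once `N_L/2 ≥ #{Δ_k = 0}` and
`L² - N_L/2 ≥ #{Δ_k = 0}`, i.e. `L` large: `Δ_k = 0` only on the two zone diagonals) the `N_L`-particle
vector `Φ_S = Π_{k∈S} b†_k |0⟩` has `⟨Φ_S, dBCS⟩ = Π_{k∈S} v_k Π_{k∉S} u_k ≠ 0`. [folklore;
Paramekanti–Randeria–Trivedi 2004 §IV footnote 31] -/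
theorem stub_rawNonvanishing_pos :
    ∀ g ∈ Set.Ioc (0 : ℝ) 1, ∀ Δv ∈ Set.Ioc (0 : ℝ) 4, ∀ μ ∈ Set.Icc (-4 : ℝ) 4,
      ∀ δ ∈ Set.Ioo (0 : ℝ) (1 / 2),
      ∃ L₀ : ℕ, ∀ L : ℕ, Even L → L₀ ≤ L →
        (fun s => projWeight g (2 * ⌊(1 - δ) * (L : ℝ) ^ 2 / 2⌋₊) s *
          ProjectedBCS.bcsState L Δv μ s) ≠ 0 := by
  sorry

/-- **STUB 6 `stub_rawNonvanishing_zero` — NON-VANISHING at `g = 0` (the RVB state; genuine).** For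
every `(Δv, μ, δ)` in the window, Anderson's RVB state `raw_L = P_G P_{N_L} |dBCS⟩` (full Gutzwiller
projection, `0^0 = 1`) is non-zero for all large even `L`: some doublon-free configuration
`(x_1…x_m ↑, y_1…y_m ↓)`, `2m = N_L`, carries non-zero amplitude `± (Π_k u_k) det[φ(x_a - y_b)]`,
`φ(r) = L⁻² Σ_k (v_k/u_k) e^{ik·r}` (Gubernatis–Kawashima–Werner 2016 §9.2.2 eq. (9.22); forced pairs where
`u_k = 0` handled separately). The load-bearing implicit lemma flagged by every review of the route
(else `χ_L = 0` and every floor is false for the wrong reason). [folklore; Gros 1989; PRT 2004 §IV] -/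
theorem stub_rawNonvanishing_zero :
    ∀ Δv ∈ Set.Ioc (0 : ℝ) 4, ∀ μ ∈ Set.Icc (-4 : ℝ) 4, ∀ δ ∈ Set.Ioo (0 : ℝ) (1 / 2),
      ∃ L₀ : ℕ, ∀ L : ℕ, Even L → L₀ ≤ L →
        (fun s => projWeight 0 (2 * ⌊(1 - δ) * (L : ℝ) ^ 2 / 2⌋₊) s *
          ProjectedBCS.bcsState L Δv μ s) ≠ 0 := by
  sorry

/-! ## Generic glue (sorry-free) -/

/-- **Mean order + a-priori bound + far-pair flatness ⇒ uniform far-pair floor** (generic bookkeeping over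
an arbitrary torus two-point family `G`): if `a L⁴ ≤ Σ_{x,y} G_L(x,y)` for even `L ≥ L₀`, `|G| ≤ C`
everywhere, and `|G_L(x,y) - G_L(x',y')| ≤ a/2` across `R`-far pairs for even `L ≥ L₁`, then for even
`L ≥ L₂` EVERY `R`-far pair has `G_L(x',y') ≥ a/4`. Proof: fix a far pair with value `v`; every far pair
is `≤ v + a/2`, every pair is `≤ C ≤ v + a/2 + 2C` (`v ≥ -C`), and at most `K L²` pairs are near
(`K = (2R+1)²`, `card_filter_torusDist_le`), so `a L⁴ ≤ Σ G ≤ (v + a/2) L⁴ + 2CK L²`, i.e.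
`v ≥ a/2 - 2CK/L² ≥ a/4` for `L ≥ 8CK/a`. [folklore] -/
theorem farFloor_of_mean_bounded_flat
    (G : (L : ℕ) → TorusSite 2 L → TorusSite 2 L → ℝ) {a C : ℝ} {R L₀ L₁ : ℕ} (ha : 0 < a)
    (hmean : ∀ (L : ℕ) [NeZero L], Even L → L₀ ≤ L →
      a * (L : ℝ) ^ 4 ≤ ∑ x : TorusSite 2 L, ∑ y : TorusSite 2 L, G L x y)
    (hbd : ∀ (L : ℕ) (x y : TorusSite 2 L), |G L x y| ≤ C)
    (hflat : ∀ L : ℕ, Even L → L₁ ≤ L → ∀ x y x' y' : TorusSite 2 L,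
      R ≤ torusDist x y → R ≤ torusDist x' y' → |G L x y - G L x' y'| ≤ a / 2) :
    ∃ L₂ : ℕ, ∀ L : ℕ, Even L → L₂ ≤ L → ∀ x' y' : TorusSite 2 L,
      R ≤ torusDist x' y' → a / 4 ≤ G L x' y' := by
  obtain ⟨L₃, hL₃⟩ := exists_nat_ge (8 * C * ((2 * (R : ℝ) + 1) ^ 2) / a)
  refine ⟨max (max L₀ L₁) (max L₃ 1), fun L hLe hL x' y' hfar => ?_⟩
  have hL0 : L₀ ≤ L := le_trans (le_max_left _ _) (le_trans (le_max_left _ _) hL)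
  have hL1 : L₁ ≤ L := le_trans (le_max_right _ _) (le_trans (le_max_left _ _) hL)
  have hL3 : L₃ ≤ L := le_trans (le_max_left _ _) (le_trans (le_max_right _ _) hL)
  have hLpos : 1 ≤ L := le_trans (le_max_right _ _) (le_trans (le_max_right _ _) hL)
  haveI : NeZero L := ⟨by omega⟩
  have hC : 0 ≤ C := (abs_nonneg _).trans (hbd L x' y')
  have hvC : -C ≤ G L x' y' := (abs_le.1 (hbd L x' y')).1
  -- pointwise: every pair is below the far level `v + a/2`, up to `2C` on the near pairs
  have hpt : ∀ x y : TorusSite 2 L, G L x y ≤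
      (G L x' y' + a / 2) + 2 * C * (if torusDist x y ≤ R then (1 : ℝ) else 0) := by
    intro x y
    by_cases h : R ≤ torusDist x y
    · have h1 := (abs_sub_le_iff.1 (hflat L hLe hL1 x y x' y' h hfar)).1
      have h2 : 0 ≤ 2 * C * (if torusDist x y ≤ R then (1 : ℝ) else 0) :=
        mul_nonneg (by linarith) (by split_ifs <;> norm_num)
      linarith
    · have hle : torusDist x y ≤ R := by omega
      rw [if_pos hle, mul_one]
      have h3 := (abs_le.1 (hbd L x y)).2
      linarith
  -- cardinalities: `L²` sites, at most `(2R+1)²` of them within distance `R` of a given one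
  have hcard : (Finset.univ : Finset (TorusSite 2 L)).card = L ^ 2 := by
    simp only [Finset.card_univ, Fintype.card_pi, ZMod.card, Finset.prod_const, Fintype.card_fin]
  have hball : ∀ x : TorusSite 2 L,
      (∑ y : TorusSite 2 L, (if torusDist x y ≤ R then (1 : ℝ) else 0)) ≤ (2 * (R : ℝ) + 1) ^ 2 := by
    intro x
    rw [Finset.sum_boole]
    exact_mod_cast card_filter_torusDist_le L x R
  -- sum the pointwise bound
  have hsum : ∑ x : TorusSite 2 L, ∑ y : TorusSite 2 L, G L x y ≤
      (G L x' y' + a / 2) * (L : ℝ) ^ 4 + 2 * C * (2 * (R : ℝ) + 1) ^ 2 * (L : ℝ) ^ 2 := by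
    have row : ∀ x : TorusSite 2 L, ∑ y : TorusSite 2 L, G L x y ≤
        (G L x' y' + a / 2) * (L : ℝ) ^ 2 + 2 * C * (2 * (R : ℝ) + 1) ^ 2 := by
      intro x
      calc ∑ y : TorusSite 2 L, G L x y
          ≤ ∑ y : TorusSite 2 L,
              ((G L x' y' + a / 2) + 2 * C * (if torusDist x y ≤ R then (1 : ℝ) else 0)) :=
            Finset.sum_le_sum fun y _ => hpt x y
        _ = (G L x' y' + a / 2) * (L : ℝ) ^ 2 +
              2 * C * ∑ y : TorusSite 2 L, (if torusDist x y ≤ R then (1 : ℝ) else 0) := by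
            rw [Finset.sum_add_distrib, Finset.sum_const, ← Finset.mul_sum, hcard, nsmul_eq_mul]
            push_cast
            ring
        _ ≤ (G L x' y' + a / 2) * (L : ℝ) ^ 2 + 2 * C * (2 * (R : ℝ) + 1) ^ 2 := by
            have h2C : 0 ≤ 2 * C := by positivity
            have := mul_le_mul_of_nonneg_left (hball x) h2C
            linarith
    calc ∑ x : TorusSite 2 L, ∑ y : TorusSite 2 L, G L x y
        ≤ ∑ x : TorusSite 2 L, ((G L x' y' + a / 2) * (L : ℝ) ^ 2 + 2 * C * (2 * (R : ℝ) + 1) ^ 2) :=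
          Finset.sum_le_sum fun x _ => row x
      _ = (G L x' y' + a / 2) * (L : ℝ) ^ 4 + 2 * C * (2 * (R : ℝ) + 1) ^ 2 * (L : ℝ) ^ 2 := by
          rw [Finset.sum_const, hcard, nsmul_eq_mul]
          push_cast
          ring
  -- conclude: `a L⁴ ≤ (v + a/2) L⁴ + 2CK L²` and `8CK L² ≤ a L⁴` give `v ≥ a/4`
  have hm := hmean L hLe hL0
  have hL1r : (1 : ℝ) ≤ (L : ℝ) := by exact_mod_cast hLpos
  have hL3r : (L₃ : ℝ) ≤ (L : ℝ) := by exact_mod_cast hL3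
  have h8 : 8 * C * (2 * (R : ℝ) + 1) ^ 2 ≤ (L : ℝ) * a := (div_le_iff₀ ha).1 (hL₃.trans hL3r)
  have h34 : (L : ℝ) ^ 3 ≤ (L : ℝ) ^ 4 := pow_le_pow_right₀ hL1r (by norm_num)
  have h8' : 8 * C * (2 * (R : ℝ) + 1) ^ 2 * (L : ℝ) ^ 2 ≤ a * (L : ℝ) ^ 4 := by
    nlinarith [mul_le_mul_of_nonneg_right h8 (sq_nonneg (L : ℝ)), mul_le_mul_of_nonneg_left h34 ha.le,
      sq_nonneg (L : ℝ)]
  have hP : (0 : ℝ) < (L : ℝ) ^ 4 := by positivity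
  have key : a / 4 * (L : ℝ) ^ 4 ≤ G L x' y' * (L : ℝ) ^ 4 := by linarith
  exact le_of_mul_le_mul_right key hP

/-- **Two-variable flatness from translation invariance and one-variable flatness** (generic): if
`G_L(x + z, y + z) = G_L(x, y)` and `r ↦ G_L(0, r)` is `ε`-flat across `‖r‖ ≥ R` (even `L ≥ L₀`), then
`G_L` is `ε`-flat across `R`-far pairs, because `G_L(x, y) = G_L(0, y - x)` and
`torusDist x y = ‖x - y‖ = ‖y - x‖` (`torusNorm_neg`). [folklore] -/
theorem flat_of_translate_flat
    (G : (L : ℕ) → TorusSite 2 L → TorusSite 2 L → ℝ) {ε : ℝ} {R L₀ : ℕ}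
    (htr : ∀ (L : ℕ) (x y z : TorusSite 2 L), G L (x + z) (y + z) = G L x y)
    (h1 : ∀ L : ℕ, Even L → L₀ ≤ L → ∀ r r' : TorusSite 2 L,
      R ≤ torusNorm r → R ≤ torusNorm r' → |G L 0 r - G L 0 r'| ≤ ε) :
    ∀ L : ℕ, Even L → L₀ ≤ L → ∀ x y x' y' : TorusSite 2 L,
      R ≤ torusDist x y → R ≤ torusDist x' y' → |G L x y - G L x' y'| ≤ ε := by
  intro L hLe hL x y x' y' hxy hxy'
  have hx : G L x y = G L 0 (y - x) := by
    rw [← htr L x y (-x), add_neg_cancel, ← sub_eq_add_neg]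
  have hx' : G L x' y' = G L 0 (y' - x') := by
    rw [← htr L x' y' (-x'), add_neg_cancel, ← sub_eq_add_neg]
  have hn : ∀ u w : TorusSite 2 L, torusDist u w = torusNorm (w - u) := fun u w => by
    rw [torusDist, ← torusNorm_neg (Ls := fun _ : Fin 2 => L) (u - w), neg_sub]
  rw [hx, hx']
  exact h1 L hLe hL (y - x) (y' - x') (by rwa [← hn]) (by rwa [← hn])

/-- `⟨c • ψ, A (c • ψ)⟩ = conj c · c · ⟨ψ, A ψ⟩`. [folklore] -/
theorem expect_smul_smul {ι : Type*} [LinearOrder ι] [Fintype ι]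
    (A : Matrix (Finset ι) (Finset ι) ℂ) (c : ℂ) (ψ : Fock ι) :
    expect A (c • ψ) = (starRingEnd ℂ c * c) * expect A ψ := by
  simp only [expect, Matrix.mulVec_smul, star_smul, smul_dotProduct, dotProduct_smul, smul_eq_mul,
    Complex.star_def]
  ring

/-- **Homogeneous order of the raw vector + non-vanishing ⇒ averaged order of the normalised family.**
For the family `χ_L = projectedBCSState g Δv μ L N_L = fockNormalize raw_L`: if `raw_L ≠ 0` and
`a L⁴ ⟨raw_L, raw_L⟩ ≤ re⟨raw_L, Δ_d†Δ_d raw_L⟩` for even `L` beyond thresholds, then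
`a L⁴ ≤ Σ_{x,y} G_χ(L; x, y)` there, because `Σ_{x,y} G_χ = re⟨χ_L, Δ_d†Δ_d χ_L⟩ = ⟨raw,raw⟩⁻¹ re⟨raw, Δ_d†Δ_d raw⟩`
(`sum_pairFieldCorr_succ`). Scalapino, Phys. Rep. 250 (1995) §2 eq. (2.4). [folklore] -/
theorem meanOrder_of_rawOrder {g Δv μ δ a : ℝ} {L₀ L₁ : ℕ}
    (hnv : ∀ L : ℕ, Even L → L₁ ≤ L →
      (fun s => projWeight g (2 * ⌊(1 - δ) * (L : ℝ) ^ 2 / 2⌋₊) s *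
        ProjectedBCS.bcsState L Δv μ s) ≠ 0)
    (hord : ∀ (L : ℕ) [NeZero L], Even L → L₀ ≤ L →
      a * (L : ℝ) ^ 4 *
          (star (fun s => projWeight g (2 * ⌊(1 - δ) * (L : ℝ) ^ 2 / 2⌋₊) s *
              ProjectedBCS.bcsState L Δv μ s) ⬝ᵥ
            (fun s => projWeight g (2 * ⌊(1 - δ) * (L : ℝ) ^ 2 / 2⌋₊) s *
              ProjectedBCS.bcsState L Δv μ s)).re ≤
        (expect ((pairField dWaveFormFactor L)ᴴ * pairField dWaveFormFactor L)
          (fun s => projWeight g (2 * ⌊(1 - δ) * (L : ℝ) ^ 2 / 2⌋₊) s *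
            ProjectedBCS.bcsState L Δv μ s)).re) :
    ∀ (L : ℕ) [NeZero L], Even L → max L₀ L₁ ≤ L →
      a * (L : ℝ) ^ 4 ≤ ∑ x : TorusSite 2 L, ∑ y : TorusSite 2 L,
        pairFieldCorr dWaveFormFactor
          (fun L => projectedBCSState g Δv μ L (2 * ⌊(1 - δ) * (L : ℝ) ^ 2 / 2⌋₊)) L x y := by
  intro L _ hLe hL
  obtain ⟨n, rfl⟩ : ∃ n, L = n + 1 := ⟨L - 1, by have := NeZero.ne L; omega⟩
  -- abbreviate the raw vector at side `n + 1`
  set raw : Fock (Orb (FermionTorus 2 (n + 1))) := fun s =>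
    projWeight g (2 * ⌊(1 - δ) * ((n + 1 : ℕ) : ℝ) ^ 2 / 2⌋₊) s *
      ProjectedBCS.bcsState (n + 1) Δv μ s with hraw
  have hne : raw ≠ 0 := hnv (n + 1) hLe ((le_max_right _ _).trans hL)
  have ho := hord (n + 1) hLe ((le_max_left _ _).trans hL)
  rw [sum_pairFieldCorr_succ]
  -- the normalised state is `c • raw`, `c = (√⟨raw,raw⟩)⁻¹`
  have hq := star_dotProduct_self_eq_sum_normSq raw
  have hpos : 0 < ∑ s, Complex.normSq (raw s) := sum_normSq_pos hne
  have hre : (star raw ⬝ᵥ raw).re = ∑ s, Complex.normSq (raw s) := by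
    rw [hq, Complex.ofReal_re]
  change a * ((n + 1 : ℕ) : ℝ) ^ 4 ≤
    (expect ((pairField dWaveFormFactor (n + 1))ᴴ * pairField dWaveFormFactor (n + 1))
      (fockNormalize raw)).re
  rw [fockNormalize_def, expect_smul_smul, Complex.conj_ofReal, ← Complex.ofReal_mul, Complex.re_ofReal_mul,
    hre, ← mul_inv, ← Real.sqrt_mul hpos.le, Real.sqrt_mul_self hpos.le]
  rw [hre] at ho
  rw [le_inv_mul_iff₀ hpos]
  linarith

/-! ## The composition: the six stubs imply the crux, by name -/

/-- **`ProjectedBCSPairLRO_of`** — the composition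
`stub_pairCorrBounded → stub_pairCorrTranslate → stub_farPairFlatness → stub_rawOrder →
stub_rawNonvanishing_pos → stub_rawNonvanishing_zero → ProjectedBCSGas.ProjectedBCSPairLRO`, realised in
the harness skeleton convention (A12: concludes the crux BY NAME, takes no hypotheses, cites the DECLARED
stubs by name; sorry-free outside the stubs). For the crux's parameters: NON-VANISHING (stub 5 or 6, by
cases on `g > 0` / `g = 0`) and the homogeneous ORDER (stub 4) give Scalapino's averaged order `a, L₀'`
(`meanOrder_of_rawOrder`); the A-PRIORI BOUND (stub 1) gives `C`; TRANSLATION (stub 2) and one-variable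
CLUSTERING (stub 3) at tolerance `a/2` give two-variable flatness (`flat_of_translate_flat`); the
averaging lemma `farFloor_of_mean_bounded_flat` turns them into the far-pair floor `a/4` beyond some
`L_*`, which is the crux with witnesses `(a/4, R, L_*)` (the crux's `let χ := …` is definitionally
`fun L => projectedBCSState g Δv μ L N_L`, `projectedBCSState_eq`). [folklore] -/
theorem ProjectedBCSPairLRO_of :
    Summit.HubbardSuperconductivity.HubbardSuperconductivity.Theses.ProjectedBCSGas.ProjectedBCSPairLRO := by
  intro g hg Δv hΔv μ hμ δ hδ
  show ∃ a > (0 : ℝ), ∃ R L₀ : ℕ, ∀ L : ℕ, Even L → L₀ ≤ L → ∀ x y : TorusSite 2 L,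
    R ≤ torusDist x y → a ≤ pairFieldCorr dWaveFormFactor
      (fun L => projectedBCSState g Δv μ L (2 * ⌊(1 - δ) * (L : ℝ) ^ 2 / 2⌋₊)) L x y
  -- NON-VANISHING of the raw vector for this `g` (STUB 5 for `g > 0`, STUB 6 at `g = 0`)
  have hnv : ∃ L₁ : ℕ, ∀ L : ℕ, Even L → L₁ ≤ L →
      (fun s => projWeight g (2 * ⌊(1 - δ) * (L : ℝ) ^ 2 / 2⌋₊) s *
        ProjectedBCS.bcsState L Δv μ s) ≠ 0 := by
    rcases hg.1.eq_or_lt with h | h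
    · subst h
      exact stub_rawNonvanishing_zero Δv hΔv μ hμ δ hδ
    · exact stub_rawNonvanishing_pos g ⟨h, hg.2⟩ Δv hΔv μ hμ δ hδ
  obtain ⟨L₁, hnv⟩ := hnv
  -- ORDER: homogeneous order of the raw vector (STUB 4), hence averaged order of `χ`
  obtain ⟨a, ha, L₀, hord⟩ := stub_rawOrder g hg Δv hΔv μ hμ δ hδ
  have hmean := meanOrder_of_rawOrder hnv hord
  -- A-PRIORI BOUND: `|G_χ| ≤ C` (STUB 1, all real parameters)
  obtain ⟨C, hbd⟩ := stub_pairCorrBounded g Δv μ δ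
  -- CLUSTERING: one-variable far flatness at tolerance `a/2` (STUB 3) + TRANSLATION (STUB 2)
  obtain ⟨R, L₂, hflat1⟩ := stub_farPairFlatness g hg Δv hΔv μ hμ δ hδ (a / 2) (half_pos ha)
  have hflat := flat_of_translate_flat _ (stub_pairCorrTranslate g Δv μ δ) hflat1
  -- averaging: uniform far-pair floor `a/4`
  obtain ⟨L₃, hfloor⟩ := farFloor_of_mean_bounded_flat _ ha hmean hbd hflat
  exact ⟨a / 4, by linarith, R, L₃, hfloor⟩

end Summit.HubbardSuperconductivity.HubbardSuperconductivity.Cruxes.ProjectedBCSPairLRO.Birth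

end
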